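import Summits.BirchSwinnertonDyer.BirchSwinnertonDyer.Theorems.EisensteinPrimesBSDpOnCellCTwistDescentCertificate
import HarnessLib

/-!
# Crux 4 `BSDpOnCellC` (stmt-BirchSwinnertonDyer-19034): the TWIST–DESCENT-CERTIFICATE road, part 2 — the layer-`k` certificate read
# on a curve `ℚ`-ISOGENOUS to the twist (the census' `model=iso` rows; cell `bsd-eis`, seat `bsd-eis-k5-p4` g0; THEOREMS ONLY)

HONEST FRAMING (cell `bsd-eis`, run/shared/lean/pub/bsd-eis/): companion of `…TwistDescentCertificate.lean` (part 1, p535407), split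
off only for the 400-line rule. Same binders, same tier (Keller–Yin Thm. D is a PREPRINT input of the b1 atoms), nothing booked,
crux 4 OPEN, BSD proved for no curve. By Cassels' isogeny invariance (Milne ADT I.7.3, `hCassels`) any member `Wc` of the twist's
isogeny class may carry the finite descent: `Wc` is X2 at `p` with `L(Wc,1) = L(Wd,1) ≠ 0`, so Wuthrich 2014 Prop. 21 +
Cassels–Tate + `p^{2k-1} ∣ #Ш(Wc)` give `BSDp Wc p`, moved to `Wd` (`X2.bsdp_of_isIsogenous_of_bsdp`), then part 1's §1 /
the sibling's `bsdp_of_cellC_of_twistPartnerBSDp`. `k = 0` is cgshw's `bsdp_of_cellC_of_isogenousTwistShaUnit` (439698ce @3).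

References: [Wuthrich2014] Prop. 21 (p. 400); [SilvermanAEC2009] Thm. X.4.14; [MilneADT2006] Thm. I.7.3; [Miller2011LMS] Def. 1.1;
[KellerYin2024] Thm. D (PRE); [CastellaEtAl2021] Thm. 5.3.1; [Hsieh2014] Thm. 1.
-/

set_option autoImplicit false
set_option linter.dupNamespace false

noncomputable section

open scoped Classical MatrixGroups ModularForm Topology

open Filter CongruenceSubgroup WeierstrassCurve NumberField IsDedekindDomain Field PowerSeries
  Literature.NumberTheory.EllipticCurves Literature.NumberTheory.EllipticCurves.GreenbergSelmer
  Literature.NumberTheory.EllipticCurves.ModularForms Literature.NumberTheory.QuadraticFields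
  Literature.NumberTheory.EllipticCurves.Rank1Residual
  Literature.NumberTheory.EllipticCurves.Rank1Residual.Typed
  Literature.NumberTheory.EllipticCurves.KrizLi2019
  Literature.NumberTheory.EllipticCurves.GreenbergVatsal2000
  Literature.NumberTheory.EllipticCurves.Wuthrich2014
  Literature.NumberTheory.EllipticCurves.SteinWuthrich2013
  Literature.NumberTheory.EllipticCurves.Castella2018
  Literature.NumberTheory.EllipticCurves.Castella2018Exceptional
  Literature.NumberTheory.GaloisRepresentations Literature.NumberTheory.GaloisCohomology
  Literature.NumberTheory.Automorphic
  Summit.BirchSwinnertonDyer.Rank1Residual.X11b.AcSelmer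
  Summit.BirchSwinnertonDyer.Rank1Residual.X11b.Halves
  Summit.BirchSwinnertonDyer.Rank1Residual.X11b
  Summit.BirchSwinnertonDyer.Rank1Residual.X2
  Summit.BirchSwinnertonDyer.Rank1Residual
  Summit.BirchSwinnertonDyer.BirchSwinnertonDyer.Theorems.Reoriented
  Summit.BirchSwinnertonDyer.BirchSwinnertonDyer.Theorems.EisensteinPrimesMazurMCOnX1RankZeroSecondDescentAlgebra

namespace Summit.BirchSwinnertonDyer.BirchSwinnertonDyer.Theorems.TwistDescentCertificate

/-! ### The certificate read on a curve `ℚ`-ISOGENOUS to the twist (Cassels) -/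

section IsogenousCertificate

variable (W : WeierstrassCurve ℚ) [W.IsElliptic] [W.IsGloballyMinimal] (p : ℕ) [Fact p.Prime]

/-- **TWIST–DESCENT DOOR with the layer-`k` certificate on ANY curve `Wc` `ℚ`-isogenous to the twist** (the census'
`model=iso` rows; by Cassels any member of the twist's isogeny class may carry the descent): `Wc` is X2 at `p` with
`L(Wc,1) = L(Wd,1) ≠ 0` (`not_hasIrreducibleModPGaloisRep_of_isIsogenous`, `hasMultiplicativeReductionAt_of_isIsogenous`),
so Wuthrich + Cassels–Tate + `p^{2k-1} ∣ #Ш(Wc)` give `BSDp Wc p`, Cassels (`X2.bsdp_of_isIsogenous_of_bsdp`) moves it to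
`Wd`, then the sibling's §1. Nothing booked. [cite: Wuthrich2014, Prop. 21 (p. 400)] [cite: SilvermanAEC2009, Thm. X.4.14]
[cite: MilneADT2006, Thm. I.7.3] [claim: KellerYin2024, status: under-review] [cite: Miller2011LMS, Def. 1.1] -/
theorem bsdp_of_cellC_of_isogenousTwistCasselsTate_pow_dvd (hW21 : sha_dvd_analyticSha)
    (hCT : exists_casselsTate_pairing (K := ℚ))
    (hnf : exists_isNewformOf)
    (hPT : ∀ (K : Type) [Field K] [NumberField K], poitouTate_selmerStructure_duality K)
    (hPT2 : ∀ (K : Type) [Field K] [NumberField K], poitouTate_sha_tateDual K)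
    (hH : hsieh2014_exists_anticyclotomicPAdicLFunction)
    (hGZ : ∀ (N : ℕ) [NeZero N] (W : WeierstrassCurve ℚ) (K : Type) [Field K] [NumberField K],
      gross_zagier N W K)
    (hKo : ∀ (N : ℕ) [NeZero N] (W : WeierstrassCurve ℚ) (K : Type) [Field K] [NumberField K],
      kolyvagin N W K)
    (hGZK : rank_eq_analyticRank_of_analyticRank_le_one)
    (hMaz : mazur_not_dvd_maninConstant_of_odd) (hCassels : bsdRHS_eq_of_isIsogenous)
    (h2 : ∀ (W' : WeierstrassCurve ℚ) [W'.IsElliptic] [W'.IsGloballyMinimal],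
      CellC W' p → BDPValueContinuousDisplayAt W' p)
    (h3n : ∀ (W' : WeierstrassCurve ℚ) [W'.IsElliptic] [W'.IsGloballyMinimal],
      CellC W' p → ¬ W'.HasSplitMultiplicativeReductionAtPrime p → NonsplitIMCEqOnTreeIntOther W' p)
    (h3s : ∀ (W' : WeierstrassCurve ℚ) [W'.IsElliptic] [W'.IsGloballyMinimal],
      CellC W' p → W'.HasSplitMultiplicativeReductionAtPrime p → SplitIMCEqOnTreeIntOther W' p)
    (hc : CellC W p)
    (K : Type) [Field K] [NumberField K] (hK : IsImaginaryQuadratic K)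
    (hodd : Odd (NumberField.discr K)) (hlt : NumberField.discr K < -4)
    (hHN : SatisfiesHeegnerHypothesis (W.conductorNorm ℤ) K) (hHp : SatisfiesHeegnerHypothesis p K)
    (hLK : (W.quadraticTwist (NumberField.discr K : ℚ)).entireLFunction 1 ≠ 0)
    (Wd : WeierstrassCurve ℚ) [Wd.IsElliptic] [Wd.IsGloballyMinimal]
    (hWd : ∃ C : VariableChange ℚ, C • Wd = W.quadraticTwist (NumberField.discr K : ℚ))
    (Wc : WeierstrassCurve ℚ) [Wc.IsElliptic] [Wc.IsGloballyMinimal] (hiso : IsIsogenous Wd Wc)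
    {q : ℚ} (hq : shaAn Wc = (q : ℂ)) {k : ℕ} (hv : padicValRat p q ≤ 2 * k)
    (hdvd : p ^ (2 * k - 1) ∣ Wc.shaOrder) : BSDp W p := by
  have hp : p.Prime := Fact.out
  have hmod : hasEntireLFunction_rat := WeierstrassCurve.hasEntireLFunction_rat_of_exists_isNewformOf hnf
  have hD0 : (NumberField.discr K : ℚ) ≠ 0 := by exact_mod_cast NumberField.discr_ne_zero K
  haveI hEt : (W.quadraticTwist (NumberField.discr K : ℚ)).IsElliptic := W.isElliptic_quadraticTwist hD0
  have hXd : ClassX2 Wd p := classX2_twist W p hc.2 K hK hHp Wd hWd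
  obtain ⟨Cd, hCd⟩ := hWd
  have hLd : Wd.entireLFunction 1 ≠ 0 := by
    rw [← entireLFunction_smul Wd Cd, hCd]; exact hLK
  -- `Wc` is X2 at `p` with `L(Wc,1) ≠ 0`
  have hLc : Wc.entireLFunction 1 ≠ 0 := by
    rw [← entireLFunction_eq_of_isIsogenous' hiso]; exact hLd
  have hrc : Wc.analyticRank = 0 := (Wc.analyticRank_eq_zero_iff_holds (hmod _)).2 hLc
  have hredc : ¬ Wc.HasIrreducibleModPGaloisRep p := not_hasIrreducibleModPGaloisRep_of_isIsogenous hiso hXd.2.1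
  have hmultc : Wc.HasMultiplicativeReductionAtPrime p := by
    have hb := WeierstrassCurve.hasMultiplicativeReductionAtPrime_iff_hasMultiplicativeReductionAt_holds
    have h1 : Wd.HasMultiplicativeReductionAt
        ((Rat.HeightOneSpectrum.primesEquiv (R := ℤ)).symm ⟨p, hp⟩) := (hb Wd ⟨p, hp⟩).mp hXd.2.2
    exact (hb Wc ⟨p, hp⟩).mpr (hasMultiplicativeReductionAt_of_isIsogenous hiso _ h1)
  have hbsdc : BSDp Wc p :=
    bsdp_of_wuthrich_of_casselsTate_of_pow_dvd Wc p hCT hW21 hGZK hmod hXd.1 hrc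
      (WeierstrassCurve.HasMultiplicativeReduction.not_hasAdditiveReduction (R := ℤ_[p]) hmultc)
      (Or.inl hredc) hq hv hdvd
  -- Cassels back to the model of the twist, then the sibling's §1
  have hbsd : BSDp Wd p :=
    bsdp_of_isIsogenous_of_bsdp hCassels hGZK hmod Wc Wd hiso.symm_of_charZero p
      (by rw [hrc]; exact zero_le_one) hbsdc
  exact bsdp_of_cellC_of_twistPartnerBSDp W p hnf hPT hPT2 hH hGZ hKo hGZK hMaz hCassels h2 h3n h3s hc K hK
    hodd hlt hHN hHp hLK Wd ⟨Cd, hCd⟩ hbsd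

end IsogenousCertificate

end Summit.BirchSwinnertonDyer.BirchSwinnertonDyer.Theorems.TwistDescentCertificate

end
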